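import Literature.IUT.HodgeTheaters.InitialThetaDataTorsionMonodromyModelGeometry
import Literature.IUT.HodgeTheaters.InitialThetaDataTorsionMonodromyProofs
import Literature.IUT.HodgeTheaters.InitialThetaDataArith
import HarnessLib

/-!
# [IUTchI] Def 3.1 (c)(d) / Def 6.1 (v): the `l`-torsion monodromy datum is INHABITED at genuine initial Θ-data —
# non-vacuity of the binder `Nonempty D.TorsionMonodromy`, and the sign law of the involution (NV-L5, proof-only)

`Proofs` companion (theorems only; no definitions, no instances) of `InitialThetaDataTorsionMonodromyModel.lean` /
`InitialThetaDataTorsionMonodromyModelGeometry.lean` (the semidirect model `Π_{C_F} := E_F[l](F̄) ⋊ (G_F × {±1})` and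
the term `InitialThetaData.torsionMonodromyRegeom`), by the cell `abc-iut`, seat abc-iut-L5-t8 (NV-L5 row
«TorsionMonodromy-NV», abc-iut-L5-lead GO 2026-08-26T10:03Z).

S. Mochizuki, *Inter-universal Teichmüller theory I*, kurims manuscript (May 2020), §3 Def 3.1 (c)(d) p. 62, §6
Def 6.1 (v) p. 158 «the outer homomorphism `Aut(𝒟^{⊚±}) → GL₂(𝔽_l)/{±1}` arising from the `l`-torsion points of the
elliptic curve `E_F` [i.e., from the Galois action on `Δ_X^{ab} ⊗ 𝔽_l`] … a natural surjective homomorphism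
`Aut(𝒟^{⊚±}) ↠ 𝔽_l^⋇`» ([IUTchI] Def 6.1 (v) p.158) [claim: Mochizuki2012, status: disputed] (D-0012 claim key; series
status DISPUTED — nothing of the series is asserted; these are kernel facts about a MODEL of the cell's interface
structures; no side is taken on [IUTchIII] Cor. 3.12).

## WHAT IS PROVED

* `InitialThetaData.nonempty_torsionMonodromy_regeom` / `exists_torsionMonodromy` — **for EVERY initial Θ-datum `D₀`
  there is an initial Θ-datum `D` with the SAME arithmetic data (`V^bad_mod`, `V̲`, hence all of (a)–(c), (e)) and
  `Nonempty D.TorsionMonodromy`** (namely `D := D₀.regeom`): the binder of abc-iut-L5-t8's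
  `toFlStarGlobal_surjective_of_torsionMonodromy` (p433603), of abc-iut-L5-t3's `toFlStarNF_surjective_of_torsionMonodromy`
  and the CERT-L5 weakening candidate `hT ↦ Nonempty D.TorsionMonodromy` is SATISFIABLE at genuine data (KIT RULE);
* `InitialThetaData.exists_ofArith_torsionMonodromy` — the same at abc-iut-L5-t7's `InitialThetaData.ofArith`: for
  every arithmetic input `ArithInput E l` (and bad-place predicates with their two clauses) there is an initial
  Θ-datum over `K := F(E_F[l])`, `F̄ := AlgebraicClosure F` with `V^bad_mod` as given and a torsion monodromy;
* `InitialThetaData.toFlStarGlobal_surjective_regeom` — **Def 6.1 (v) `Aut(𝒟^{⊚±}) ↠ 𝔽_l^⋇` FIRES** at `D₀.regeom`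
  with NO binder left (`hT` and the `Normal` instance both come from the monodromy term);
* `TorsionMonodromyModel.pt_left_conj` and `InitialThetaData.tau_regeom_conj_of_mem_PiCund` — **the sign law of the
  involution**: for `c ∈ Π_{C̲_K} ∖ Π_{X̲_K}` and `k ∈ Δ_X`, `τ(c k c⁻¹) = −τ(k)` (abc-iut-w4-d061's `hι`
  «the inversion acts by `−1` on `Δ_X^{ab} ⊗ 𝔽_l ≅ E_F[l]`», GAP G-w4d061-1, true in the model — print's
  «`C̲_K` of type `(1, l-tors)±`»); in general `τ(c k c⁻¹) = sgn(c) · σ_c(τ k)` for every `c ∈ Π_{C_F}`.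

HONEST LABEL: instantiated ≠ endorsed; a model inhabits the interface, it does not construct `π₁` of a curve.
-/

noncomputable section

namespace Literature.IUT.HodgeTheaters

universe u

open scoped WeierstrassCurve.Affine Classical

/-! ## Model-level conjugation formulas -/

namespace TorsionMonodromyModel

variable {F : Type u} [Field F] {E : WeierstrassCurve F} {Fbar : Type u} [Field Fbar] [Algebra F Fbar] {l : ℕ}

/-- **Conjugation in the model**: `g · inl t · g⁻¹ = inl (act g.right t)`, i.e. `Π_{C_F}` acts on `Δ_X = E_F[l](F̄)` through
`sgn(g) · ρ(σ_g)` (the normal factor is commutative). [cite: Mochizuki2012, IUTchI Def 6.1 (v) p.158] -/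
theorem conj_inl (g : PiC F E Fbar l) (t : Tors E Fbar l) :
    g * SemidirectProduct.inl t * g⁻¹ = SemidirectProduct.inl (act F E Fbar l g.right t) := by
  conv_lhs => rw [← SemidirectProduct.inl_left_mul_inr_right g]
  rw [mul_inv_rev, ← map_inv, ← map_inv]
  calc SemidirectProduct.inl g.left * SemidirectProduct.inr g.right * SemidirectProduct.inl t *
        (SemidirectProduct.inr g.right⁻¹ * SemidirectProduct.inl g.left⁻¹)
      = SemidirectProduct.inl g.left *
          (SemidirectProduct.inr g.right * SemidirectProduct.inl t * SemidirectProduct.inr g.right⁻¹) *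
          SemidirectProduct.inl g.left⁻¹ := by simp only [mul_assoc]
    _ = SemidirectProduct.inl (g.left * act F E Fbar l g.right t * g.left⁻¹) := by
        rw [← SemidirectProduct.inl_aut, map_mul, map_mul]
    _ = SemidirectProduct.inl (act F E Fbar l g.right t) := by rw [mul_comm g.left, mul_inv_cancel_right]

/-- An element of `Π_{C_F}` with trivial `G_F × {±1}`-component is `inl` of its torsion coordinate.
[cite: Mochizuki2012, IUTchI Def 3.1 (b) p.61] -/
theorem eq_inl_of_right_eq_one {k : PiC F E Fbar l} (hk : k.right = 1) : k = SemidirectProduct.inl k.left := by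
  rw [← SemidirectProduct.inl_left_mul_inr_right k, hk, map_one, mul_one, SemidirectProduct.left_inl]

/-- **Conjugation on `Δ_X = E_F[l](F̄)`**: for `c ∈ Π_{C_F}` and `k` with trivial `G_F × {±1}`-component,
`τ(c k c⁻¹) = sgn(c) · σ_c(τ k)` — the Galois action twisted by the sign of the involution ([IUTchI] Def 6.1 (v)
«from the Galois action on `Δ_X^{ab} ⊗ 𝔽_l`», «type `(1, l-tors)±`»). [cite: Mochizuki2012, IUTchI Def 6.1 (v) p.158] -/
theorem pt_left_conj {k : PiC F E Fbar l} (hk : k.right = 1) (c : PiC F E Fbar l) :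
    Tors.pt (c * k * c⁻¹).left = (c.right.2 : ℤ) • galoisAct E c.right.1 (Tors.pt k.left) := by
  conv_lhs => rw [eq_inl_of_right_eq_one hk, conj_inl, SemidirectProduct.left_inl]
  exact pt_act E Fbar l c.right k.left

/-- The involution case: `c = ⟨·, (σ, −1)⟩` with `σ` fixing the `l`-torsion acts by `−1` on `Δ_X`.
[cite: Mochizuki2012, IUTchI Def 3.1 (d) p.62] -/
theorem pt_left_conj_eq_neg {k : PiC F E Fbar l} (hk : k.right = 1) {c : PiC F E Fbar l}
    (hσ : FixesTorsion E l c.right.1) (hu : c.right.2 = -1) :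
    Tors.pt (c * k * c⁻¹).left = -Tors.pt k.left := by
  rw [pt_left_conj hk, hu, hσ _ (Tors.torsion_pt _), Units.val_neg, Units.val_one, neg_smul, one_smul]

end TorsionMonodromyModel

/-! ## Non-vacuity of `TorsionMonodromy` at genuine initial Θ-data -/

namespace InitialThetaData

open TorsionMonodromyModel

variable {F K Fbar : Type u} [Field F] [NumberField F] [Field K] [NumberField K] [Algebra F K] [Field Fbar]
  [Algebra F Fbar] [Algebra K Fbar] {E : WeierstrassCurve F} [E.IsElliptic] {l : ℕ} {Pb : BadPlacePredicates K}

/-- The re-geometrised datum keeps `V^bad_mod`. [cite: Mochizuki2012, IUTchI Def 3.1 (b) p.61] -/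
theorem regeom_VbadMod (D₀ : InitialThetaData F K Fbar E l Pb) : D₀.regeom.VbadMod = D₀.VbadMod := rfl

/-- The re-geometrised datum keeps `V̲`. [cite: Mochizuki2012, IUTchI Def 3.1 (e) p.62] -/
theorem regeom_V (D₀ : InitialThetaData F K Fbar E l Pb) : D₀.regeom.V = D₀.V := rfl

/-- **NON-VACUITY of the `l`-torsion monodromy datum**: the re-geometrised initial Θ-datum CARRIES a `TorsionMonodromy`.
[cite: Mochizuki2012, IUTchI Def 6.1 (v) p.158] -/
theorem nonempty_torsionMonodromy_regeom (D₀ : InitialThetaData F K Fbar E l Pb) :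
    Nonempty D₀.regeom.TorsionMonodromy :=
  ⟨D₀.torsionMonodromyRegeom⟩

/-- **For every initial Θ-datum there is one with the same arithmetic data (`V^bad_mod`, `V̲`) and a torsion
monodromy** — the binder `Nonempty D.TorsionMonodromy` is satisfiable at genuine data (KIT RULE non-vacuity).
[cite: Mochizuki2012, IUTchI Def 6.1 (v) p.158] -/
theorem exists_torsionMonodromy (D₀ : InitialThetaData F K Fbar E l Pb) :
    ∃ D : InitialThetaData F K Fbar E l Pb, D.VbadMod = D₀.VbadMod ∧ D.V = D₀.V ∧ Nonempty D.TorsionMonodromy :=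
  ⟨D₀.regeom, rfl, rfl, D₀.nonempty_torsionMonodromy_regeom⟩

/-- **[IUTchI] Def 6.1 (v) «a natural surjective homomorphism `Aut(𝒟^{⊚±}) ↠ 𝔽_l^⋇`» FIRES at the re-geometrised
datum with NO binder**: abc-iut-L5-t8's `toFlStarGlobal_surjective_of_torsionMonodromy` with its `hT` and `Normal`
hypotheses both supplied by the monodromy term. [cite: Mochizuki2012, IUTchI Def 6.1 (v) p.158] -/
theorem toFlStarGlobal_surjective_regeom (D₀ : InitialThetaData F K Fbar E l Pb) [Fact l.Prime] :
    haveI := D₀.torsionMonodromyRegeom.normal_PiXund_subgroupOf_PiXK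
    Function.Surjective D₀.regeom.toFlStarGlobal :=
  haveI := D₀.torsionMonodromyRegeom.normal_PiXund_subgroupOf_PiXK
  D₀.regeom.toFlStarGlobal_surjective_of_torsionMonodromy D₀.torsionMonodromyRegeom

/-- … hence `[Aut(𝒟^{⊚±}) : Aut_±(𝒟^{⊚±})] = l⋇` at the re-geometrised datum, with no binder.
[cite: Mochizuki2012, IUTchI Def 6.1 (v) p.158] -/
theorem index_ker_toFlStarGlobal_regeom (D₀ : InitialThetaData F K Fbar E l Pb) [Fact l.Prime] :
    haveI := D₀.torsionMonodromyRegeom.normal_PiXund_subgroupOf_PiXK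
    (D₀.regeom.toFlStarGlobal).ker.index = lStar l :=
  haveI := D₀.torsionMonodromyRegeom.normal_PiXund_subgroupOf_PiXK
  D₀.regeom.index_ker_toFlStarGlobal_of_torsionMonodromy D₀.torsionMonodromyRegeom

/-! ### The sign law of the involution (abc-iut-w4-d061's `hι`, GAP G-w4d061-1), in the model -/

/-- `τ(c k c⁻¹) = sgn(c) · σ_c(τ k)` for every `c ∈ Π_{C_F}` and `k ∈ Δ_X` at the re-geometrised datum: the
`Π_{C_F}`-action on `Δ_X^{ab} ⊗ 𝔽_l ≅ E_F[l](F̄)` is the Galois action twisted by the sign of `Gal(X_F/C_F)`.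
[cite: Mochizuki2012, IUTchI Def 6.1 (v) p.158] -/
theorem tau_regeom_conj (D₀ : InitialThetaData F K Fbar E l Pb) (c : D₀.regeom.PiC) {k : D₀.regeom.PiC}
    (hk : k ∈ D₀.regeom.DeltaX) :
    D₀.torsionMonodromyRegeom.tau (c * k * c⁻¹) =
      ((c : TorsionMonodromyModel.PiC F E Fbar l).right.2 : ℤ) •
        galoisAct E (D₀.regeom.augGF c) (D₀.torsionMonodromyRegeom.tau k) := by
  haveI := D₀.isAlgClosure
  haveI := D₀.isScalarTower
  haveI : NeZero l := ⟨D₀.l_prime.ne_zero⟩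
  have hk1 : (k : TorsionMonodromyModel.PiC F E Fbar l).right = 1 :=
    Prod.ext ((TorsionMonodromyModel.mem_geom_ext_iff E Fbar l _).mp hk.2)
      ((TorsionMonodromyModel.mem_PiX_iff E Fbar l _).mp hk.1)
  exact pt_left_conj hk1 c

/-- **The involution acts by `−1` on `Δ_X^{ab} ⊗ 𝔽_l`** at the re-geometrised datum: for `c ∈ Π_{C̲_K} ∖ Π_{X̲_K}` and
`k ∈ Δ_X`, `τ(c k c⁻¹) = −τ(k)` — abc-iut-w4-d061's law `hι` (GAP G-w4d061-1; print: «`C̲_K` … of type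
`(1, l-tors)±`», [EtTh] Def 2.1) holds in the model. [cite: Mochizuki2012, IUTchI Def 3.1 (d) p.62] -/
theorem tau_regeom_conj_of_mem_PiCund (D₀ : InitialThetaData F K Fbar E l Pb) {c : D₀.regeom.PiC}
    (hc : c ∈ D₀.regeom.PiCund) (hc' : c ∉ D₀.regeom.PiXund) {k : D₀.regeom.PiC} (hk : k ∈ D₀.regeom.DeltaX) :
    D₀.torsionMonodromyRegeom.tau (c * k * c⁻¹) = -D₀.torsionMonodromyRegeom.tau k := by
  haveI := D₀.isAlgClosure
  haveI := D₀.isScalarTower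
  haveI : NeZero l := ⟨D₀.l_prime.ne_zero⟩
  haveI : CompactSpace (galoisSubgroupOf F K Fbar) :=
    isCompact_iff_compactSpace.mp (ThetaGeometryModel.isClosed_galoisSubgroupOf F K Fbar).isCompact
  have hk1 : (k : TorsionMonodromyModel.PiC F E Fbar l).right = 1 :=
    Prod.ext ((TorsionMonodromyModel.mem_geom_ext_iff E Fbar l _).mp hk.2)
      ((TorsionMonodromyModel.mem_PiX_iff E Fbar l _).mp hk.1)
  obtain ⟨y, hy, rfl⟩ := hc
  have hu : y.2.right ≠ 1 := fun h1 => hc' ⟨y, ⟨mem_lift.mpr ((Dih.mem_dX_iff _).mpr h1), hy⟩, rfl⟩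
  have hu' : y.2.right = -1 := (Int.units_eq_one_or y.2.right).resolve_left hu
  exact pt_left_conj_eq_neg hk1 (D₀.fixesTorsion_of_mem_galoisSubgroupOf _ y.1.2) hu'

/-! ### At the arithmetic constructor `InitialThetaData.ofArith` -/

omit [NumberField K] [Algebra F K] [Algebra K Fbar] in
/-- **For every arithmetic input there is an initial Θ-datum with a torsion monodromy** (over `K := F(E_F[l])`,
`F̄ := AlgebraicClosure F`, with the given `V^bad_mod` and bad-place predicates): abc-iut-L5-t7's `ofArith` followed by
`regeom`. [cite: Mochizuki2012, IUTchI Def 6.1 (v) p.158] -/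
theorem exists_ofArith_torsionMonodromy (A : ArithInput E l) [NeZero l] (Pb : BadPlacePredicates (TorsionField E l))
    (hbad_type : ∀ w : Val (TorsionField E l),
      toVMod F (TorsionField E l) E w ∈ Val.non '' A.VbadMod → Pb.IsTypeOneZModLPM w)
    (hbad_cusp : ∀ w : Val (TorsionField E l),
      toVMod F (TorsionField E l) E w ∈ Val.non '' A.VbadMod → Pb.IsCanonicalGeneratorCusp w) :
    ∃ D : InitialThetaData F (TorsionField E l) (AlgebraicClosure F) E l Pb,
      D.VbadMod = A.VbadMod ∧ Nonempty D.TorsionMonodromy := by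
  haveI : IsGalois F (AlgebraicClosure F) := {}
  obtain ⟨geom⟩ := ThetaGeometryModel.nonempty_thetaGeometry_galois F (TorsionField E l) (AlgebraicClosure F)
    A.five_le_l (TorsionMonodromyModel.coprime_six_of_prime l A.l_prime A.five_le_l)
  let D₀ := InitialThetaData.ofArith E l A Pb geom hbad_type hbad_cusp
  exact ⟨D₀.regeom, rfl, D₀.nonempty_torsionMonodromy_regeom⟩

omit [NumberField K] [Algebra F K] [Algebra K Fbar] in
/-- The same with the trivial bad-place predicates (`BadPlacePredicates.trivial`): an initial Θ-datum with a torsion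
monodromy EXISTS for every arithmetic input. [cite: Mochizuki2012, IUTchI Def 6.1 (v) p.158] -/
theorem exists_ofArith_torsionMonodromy_trivial (A : ArithInput E l) [NeZero l] :
    ∃ D : InitialThetaData F (TorsionField E l) (AlgebraicClosure F) E l (BadPlacePredicates.trivial _),
      D.VbadMod = A.VbadMod ∧ Nonempty D.TorsionMonodromy :=
  exists_ofArith_torsionMonodromy A _ (fun _ _ => trivial) (fun _ _ => trivial)

end InitialThetaData

end Literature.IUT.HodgeTheaters

end
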